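import Mathlib
import HarnessLib
import Summits.HubbardSuperconductivity.HubbardSuperconductivity.Theorems.KLProgrammeKLRegimeSplitGenericV4
import Summits.HubbardSuperconductivity.HubbardSuperconductivity.Theorems.KLProgrammeKLRegimeSplitSlotsV17F2
import Summits.HubbardSuperconductivity.HubbardSuperconductivity.Theorems.KLProgrammeKLRegimeSplitFlowPieceOscDefs

/-!
# Route `KLProgramme` — VL item stmt-HubbardSuperconductivity-23356 `KLRegimeVolumeLimitV17F3`, atom «HOsc» (the (K5′) mean-free flow-piece clauses
# `FlowPieceOscAt … m`, `1 ≤ m < n_β + 1`, eventually in the volume): «(VL)-HOSC-BRIDGE» — THE ATOM FROM THE THREE K3 CHILDREN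
# (cell gate-hubbard-kl, seat p2 g25; pen (R294)(V4), KL STATUS 2026-08-28 23:32Z / p2 g25 23:5xZ «(VL)-HOSC-PREFIX»)

WHAT.  The VL producer `srcProfilesH_of_atoms` (…TwoVolumeSrcTowerProducer) reads the atom
`HOsc : ∀ P R, P.WF → R.WF2 → ∃ c₇ … ∀ m, 1 ≤ m → m < n_β + 1 → FlowPieceOscAt L M (klReadOscC P R) β U μ m` (VL lead, ATOMS-v12W5.txt).  At a FIXED scale and
volume the clause is a NAMED consequence of stub (C)'s registered pair through the bridge `flowPieceOscAt_of_readOscAt_of_readJetBound`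
(…SplitFlowPieceOscDefs §3, same constant), and the registered 20437 skeleton's §C already derives, from its seven stubs, the export
«`HistP … 0 k → ∀ m, 1 ≤ m → m < k → FlowPieceOscAt … m` at every volume above the engine thresholds» (`hoscV`).  But (C)ₘ's binders live ALONG A
TOWER, and the closed children give towers only at their own witnesses (`BetaSplitP`: `∀ G ∃ P`; `CountertermP2`: `∀ G P ∃ R`) — so what the K3 material
proves is the atom with an EXISTENTIAL constant («(VL)-HOSC-PREFIX»: the printed `(P,R)`-keyed constant `klReadOscC P R` is reachable at ONE `(P₁, R₂)` only).
This file is the K3-glue-level composition, TOKEN-GENERIC (no engine token is named, so the rev-15 re-render of 20437 does not touch it):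

* **`hoscAtom_of_children`** — `BetaSplitP klPredsV17F2 klWindowC` (item 20438 ✓) → `CountertermP2 klPredsV17F2 klWindowC` (item 20439 ✓) →
  «ENGINE-WITH-OSC-EXPORT» (the text of `EngineP4 klPredsV17F2 klWindowC` with ONE more existential `∃ c″ ≥ 0` after `c₃` and ONE more conjunct
  `∀ m, 1 ≤ m → m < n → FlowPieceOscAt L M c″ β U μ m` in the conclusion — from the seven v2x stubs it is `engine_slots_of_stubs_v2x` + `hoscV` with the
  witnesses of `engineP4_klPredsV17F2_of_stubs_v2x` and `c″ := klReadOscC P R`) → **HOsc′** := the atom with `∃ c″ ≥ 0` right after the WF's (the `(P, R)`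
  binders kept as dummies so the producer's call site changes by one `obtain`).  Proof = `inductionP4`'s tower half VERBATIM (`Child.allScales` for children
  3 + 1, child 2's frame and thresholds, the history at the top) + the export at `k = n_β + 1`.
* `engineP4_of_engineP4Osc` — the augmented engine text implies `EngineP4 klPredsV17F2 klWindowC` (drop the conjunct): nothing is lost.

Pure composition modulo the three named hypotheses; nothing here asserts HOsc, HOsc′, any stub of 20437, VL, K3 or superconductivity.
References: BGM 2006 §2.4 (2.36) (the `C_j U²` value law of the flow pieces) [cite: BenfattoGiulianiMastropietro2006].
-/

noncomputable section

namespace Summit.HubbardSuperconductivity.HubbardSuperconductivity.Theorems.KLRegimeSplit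

set_option linter.dupNamespace false -- summit = problem name (single-conjunct summit), D-0017

open Real Literature.MathematicalPhysics.QuantumLattice Literature.Probability.LatticeModels
open Literature.MathematicalPhysics.QuantumLattice.FermiRG
open Summit.HubbardSuperconductivity.HubbardSuperconductivity.Theorems.KLProgrammeLegKernels
open Summit.HubbardSuperconductivity.HubbardSuperconductivity.Theorems.DispersionFlow

/-- `EngineP4 klPredsV17F2 klWindowC` WITH THE (K5′) OSC EXPORT implies `EngineP4 klPredsV17F2 klWindowC` (forget the export). -/
theorem engineP4_of_engineP4Osc
    (hE : ∃ G : GeoConsts, G.WF ∧ ∀ P : SplitConsts, P.WF → ∀ R : RenConsts, R.WF2 → ∃ Q : EngConsts, Q.WF ∧ ∃ c₃ : ℝ, 0 < c₃ ∧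
      ∃ c'' : ℝ, 0 ≤ c'' ∧ ∀ c : ℝ, 0 < c → c ≤ c₃ →
        ∃ U₀ : ℝ, 0 < U₀ ∧ ∃ L₃ : ℝ → ℝ → ℕ, ∃ M₃ : ℝ → ℝ → ℕ → ℕ,
          ∀ μ ∈ klWindowC, ∀ U : ℝ, 0 < U → U ≤ U₀ → ∀ β : ℝ, klBetaMin ≤ β → β ≤ Real.exp (c / U ^ 2) →
            ∀ K : TrigPolyC4v, klPredsV17F2.frameOK R U (nScales β) μ K →
              ∀ (L M : ℕ) [NeZero L] [NeZero M], L₃ β U ≤ L → M₃ β U L ≤ M →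
                ∀ n : ℕ, n ≤ nScales β + 1 → IsKLRegime U c (-(n : ℤ)) → HistP klPredsV17F2 L M G P Q R β U μ K n →
                  (klPredsV17F2.engine L M G P Q β U μ K n ∧ klPredsV17F2.twoLeg L M G P Q R β U μ K n) ∧
                    ∀ m : ℕ, 1 ≤ m → m < n → FlowPieceOscAt L M c'' β U μ m) :
    EngineP4 klPredsV17F2 klWindowC := by
  obtain ⟨G, hG, hGP⟩ := hE
  refine ⟨G, hG, fun P hP R hR => ?_⟩
  obtain ⟨Q, hQ, c₃, hc₃, c'', -, hc⟩ := hGP P hP R hR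
  refine ⟨Q, hQ, c₃, hc₃, fun c hc' hc3 => ?_⟩
  obtain ⟨U₀, hU₀, L₃, M₃, hmain⟩ := hc c hc' hc3
  exact ⟨U₀, hU₀, L₃, M₃, fun μ hμ U hU hUle β hβ hβc K hK L M _ _ hL hM n hn hkl hhist =>
    (hmain μ hμ U hU hUle β hβ hβc K hK L M hL hM n hn hkl hhist).1⟩

/-- **«(VL)-HOSC-BRIDGE»: THE ATOM HOsc′ FROM THE THREE K3 CHILDREN.**  Children 1 (`BetaSplitP`, ✓) and 2 (`CountertermP2`, ✓) on the covariance window and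
the engine child's text WITH the (K5′) osc export give, for every `(P, R)` (dummies), a constant `c″ ≥ 0`, a regime constant `c₇ > 0` and, for `0 < c ≤ c₇`, a
coupling threshold `U₇ > 0` such that at every `μ ∈ klWindowC`, `0 < U ≤ U₇`, `klBetaMin ≤ β ≤ exp(c/U²)` there are volume thresholds beyond which
`FlowPieceOscAt L M c″ β U μ m` holds at every `1 ≤ m < n_β + 1`.  Order of choices `G → P₁ → R₂ → (Q, c₃, c″) → (c₀, c₁) → c₇ := min (min c₀ c₁) c₃ → U₇`;
per `(μ, U, β)`: the glued strong induction of children 3 + 1 for every admissible frame, child 2's frame beyond the maxed thresholds, the history at the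
top, the export at `k = n_β + 1` — `inductionP4`'s tower half verbatim. [cite: BenfattoGiulianiMastropietro2006, §2.4 (2.36)] -/
theorem hoscAtom_of_children (h₁ : BetaSplitP klPredsV17F2 klWindowC) (h₂ : CountertermP2 klPredsV17F2 klWindowC)
    (hE : ∃ G : GeoConsts, G.WF ∧ ∀ P : SplitConsts, P.WF → ∀ R : RenConsts, R.WF2 → ∃ Q : EngConsts, Q.WF ∧ ∃ c₃ : ℝ, 0 < c₃ ∧
      ∃ c'' : ℝ, 0 ≤ c'' ∧ ∀ c : ℝ, 0 < c → c ≤ c₃ →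
        ∃ U₀ : ℝ, 0 < U₀ ∧ ∃ L₃ : ℝ → ℝ → ℕ, ∃ M₃ : ℝ → ℝ → ℕ → ℕ,
          ∀ μ ∈ klWindowC, ∀ U : ℝ, 0 < U → U ≤ U₀ → ∀ β : ℝ, klBetaMin ≤ β → β ≤ Real.exp (c / U ^ 2) →
            ∀ K : TrigPolyC4v, klPredsV17F2.frameOK R U (nScales β) μ K →
              ∀ (L M : ℕ) [NeZero L] [NeZero M], L₃ β U ≤ L → M₃ β U L ≤ M →
                ∀ n : ℕ, n ≤ nScales β + 1 → IsKLRegime U c (-(n : ℤ)) → HistP klPredsV17F2 L M G P Q R β U μ K n →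
                  (klPredsV17F2.engine L M G P Q β U μ K n ∧ klPredsV17F2.twoLeg L M G P Q R β U μ K n) ∧
                    ∀ m : ℕ, 1 ≤ m → m < n → FlowPieceOscAt L M c'' β U μ m) :
    ∀ (P : SplitConsts) (R : RenConsts), P.WF → R.WF2 →
      ∃ c'' : ℝ, 0 ≤ c'' ∧ ∃ c₇ : ℝ, 0 < c₇ ∧ ∀ c : ℝ, 0 < c → c ≤ c₇ → ∃ U₇ : ℝ, 0 < U₇ ∧
        ∀ μ ∈ klWindowC, ∀ U : ℝ, 0 < U → U ≤ U₇ → ∀ β : ℝ, klBetaMin ≤ β → β ≤ Real.exp (c / U ^ 2) →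
          ∃ L₂ : ℕ, ∃ M₂ : ℕ → ℕ, ∀ (L M : ℕ) [NeZero L] [NeZero M], L₂ ≤ L → M₂ L ≤ M →
            ∀ m : ℕ, 1 ≤ m → m < nScales β + 1 → FlowPieceOscAt L M c'' β U μ m := by
  intro _ _ _ _
  obtain ⟨G, hG, hEP⟩ := hE
  obtain ⟨P, hP, h₁Q⟩ := h₁ G hG
  obtain ⟨R, hR2, h₂Q⟩ := h₂ G P hG hP
  have hR : R.WF := hR2.wf
  obtain ⟨Q, hQ, c₃, hc₃, c'', hc'', hEc⟩ := hEP P hP R hR2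
  obtain ⟨c₀, hc₀, h₁c⟩ := h₁Q Q hQ
  obtain ⟨c₁, hc₁, h₂c⟩ := h₂Q Q hQ
  refine ⟨c'', hc'', min (min c₀ c₁) c₃, lt_min (lt_min hc₀ hc₁) hc₃, fun c hc hc7 => ?_⟩
  have hcc₀ : c ≤ c₀ := hc7.trans ((min_le_left _ _).trans (min_le_left _ _))
  have hcc₁ : c ≤ c₁ := hc7.trans ((min_le_left _ _).trans (min_le_right _ _))
  have hcc₃ : c ≤ c₃ := hc7.trans (min_le_right _ _)
  obtain ⟨U₃, hU₃, L₃, M₃, h₃main⟩ := hEc c hc hcc₃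
  obtain ⟨U₁, hU₁, L₁, M₁, h₁main⟩ := h₁c c hc hcc₀ R hR
  obtain ⟨U₂, hU₂, h₂main⟩ := h₂c c hc hcc₁
  refine ⟨min (min U₁ U₂) U₃, lt_min (lt_min hU₁ hU₂) hU₃, fun μ hμ U hU hUle β hβmin hβc => ?_⟩
  have hU1 : U ≤ U₁ := hUle.trans ((min_le_left _ _).trans (min_le_left _ _))
  have hU2 : U ≤ U₂ := hUle.trans ((min_le_left _ _).trans (min_le_right _ _))
  have hU3 : U ≤ U₃ := hUle.trans (min_le_right _ _)
  have hKL : ∀ n ≤ nScales β + 1, IsKLRegime U c (-(n : ℤ)) := fun n hn =>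
    isKLRegime_of_le_nScales_succ hc.le hβmin hβc hn
  -- the glued induction (children 3 + 1) up to `n_β` for EVERY admissible frame, beyond the maxed hypothesis thresholds
  have hall : ∀ K : TrigPolyC4v, klPredsV17F2.frameOK R U (nScales β) μ K →
      ∀ (L M : ℕ) [NeZero L] [NeZero M], max (L₃ β U) (L₁ β U) ≤ L → max (M₃ β U L) (M₁ β U L) ≤ M →
        ∀ n : ℕ, n ≤ nScales β → (∀ j < n, klPredsV17F2.renorm L M β U μ K R j) →
          klPredsV17F2.engine L M G P Q β U μ K n ∧ klPredsV17F2.twoLeg L M G P Q R β U μ K n ∧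
            klPredsV17F2.split L M G P Q β U μ K n := by
    intro K hK L M _ _ hL hM n hn hRn
    have hL3 : L₃ β U ≤ L := (le_max_left _ _).trans hL
    have hL1 : L₁ β U ≤ L := (le_max_right _ _).trans hL
    have hM3 : M₃ β U L ≤ M := (le_max_left _ _).trans hM
    have hM1 : M₁ β U L ≤ M := (le_max_right _ _).trans hM
    exact Child.allScales (N := nScales β) (KL := fun n => IsKLRegime U c (-(n : ℤ)))
      (B := fun n => klPredsV17F2.split L M G P Q β U μ K n) (Rn := fun n => klPredsV17F2.renorm L M β U μ K R n)
      (E := fun n => klPredsV17F2.engine L M G P Q β U μ K n) (T := fun n => klPredsV17F2.twoLeg L M G P Q R β U μ K n)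
      (fun n hn hkl hyp => (h₃main μ hμ U hU hU3 β hβmin hβc K hK L M hL3 hM3 n (Nat.le_succ_of_le hn) hkl hyp).1)
      (fun n hn hkl hyp hEn hTn => h₁main μ hμ U hU hU1 β hβmin hβc K hK L M hL1 hM1 n hn hkl hyp hEn hTn)
      (fun n hn => hKL n (Nat.le_succ_of_le hn)) n hn hRn
  -- child 2: the volume-uniform renormalised admissible frame and its thresholds
  obtain ⟨K, hK, Lc, Mc, hKR⟩ :=
    h₂main μ hμ U hU hU2 β hβmin hβc (max (L₃ β U) (L₁ β U)) (fun L => max (M₃ β U L) (M₁ β U L)) hall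
  refine ⟨max Lc (max (L₃ β U) (L₁ β U)), fun L => max (Mc L) (max (M₃ β U L) (M₁ β U L)), fun L M _ _ hL hM => ?_⟩
  have hLc : Lc ≤ L := (le_max_left _ _).trans hL
  have hLh : max (L₃ β U) (L₁ β U) ≤ L := (le_max_right _ _).trans hL
  have hL3 : L₃ β U ≤ L := (le_max_left _ _).trans hLh
  have hMc : Mc L ≤ M := (le_max_left _ _).trans hM
  have hMh : max (M₃ β U L) (M₁ β U L) ≤ M := (le_max_right _ _).trans hM
  have hM3 : M₃ β U L ≤ M := (le_max_left _ _).trans hMh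
  -- the tower of K at (L, M) up to `n_β`, hence the history at the top
  have hle : ∀ n : ℕ, n ≤ nScales β →
      klPredsV17F2.renorm L M β U μ K R n ∧ klPredsV17F2.split L M G P Q β U μ K n ∧
        klPredsV17F2.engine L M G P Q β U μ K n ∧ klPredsV17F2.twoLeg L M G P Q R β U μ K n := by
    intro n hn
    have h := hall K hK L M hLh hMh n hn fun j hj => hKR L M hLc hMc j (le_of_lt (lt_of_lt_of_le hj hn))
    exact ⟨hKR L M hLc hMc n hn, h.2.2, h.1, h.2.1⟩
  have hhist : HistP klPredsV17F2 L M G P Q R β U μ K (nScales β + 1) := by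
    intro j hj
    have h := hle j (Nat.lt_succ_iff.mp hj)
    exact ⟨h.2.1, h.1, h.2.2.1, h.2.2.2⟩
  -- the export at the top index
  exact (h₃main μ hμ U hU hU3 β hβmin hβc K hK L M hL3 hM3 (nScales β + 1) le_rfl (hKL _ le_rfl) hhist).2

end Summit.HubbardSuperconductivity.HubbardSuperconductivity.Theorems.KLRegimeSplit

end
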